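import Summits.NavierStokesRegularity.NavierStokesRegularity.Theorems.ClockStretchingLawSteadySliceLiouvilleAnalytic
import Summits.NavierStokesRegularity.NavierStokesRegularity.Theorems.ClockStretchingLawClockCeilingUniformVorticityFloor
import Literature.Analysis.FluidPDE.CurlFreeLiouville
import Literature.Analysis.FluidPDE.TypeIAncientMild
import Literature.Analysis.FluidPDE.NSLocalLerayBackwardUniqueness
import HarnessLib

/-!
# Route ClockStretchingLaw, crux `ClockCeiling` (stmt-NavierStokesRegularity-10570), line `registered` —
# portrait clause S: the vorticity of a nonzero Type-I ancient mild field has no open zero set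

`stub_openSetVorticityLiouville`: if `u` is an element of the Type-I ancient mild class
(`IsTypeIAncientMild C u`: jointly smooth on `t < 0`, divergence free, KNSS/Oseen mild between all
pairs `s < t < 0`, `‖u(t,x)‖ ≤ C/√(−t)`) and the vorticity `curl u(t₀, ·)` of ONE slice (`t₀ < 0`)
vanishes on a nonempty open set `U ⊆ ℝ³`, then `u ≡ 0` on the whole open slab `t < 0`.

## Proof

1. *Analyticity.* `uncurry u` is jointly real-analytic on `(−∞,0) × ℝ³`
   (`analyticOnNhd_uncurry_of_oseenMild`: Lemarié-Rieusset 2016 Thm. 9.12 + uniqueness of bounded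
   Oseen-mild solutions), hence so are the slice `u(t₀, ·)` (`analyticOnNhd_slice`), its curl
   (`analyticOnNhd_curl`) and every time curve `s ↦ u(s, x)` (`AnalyticAt.curry_left`).
2. *Identity theorem in space.* `curl u(t₀, ·)` vanishes on the nonempty open `U`, hence on the
   connected `ℝ³` (`curl_eq_zero_of_eqOn_open`).
3. *KNSS 2009 Lemma 3.1.* A bounded curl-free divergence-free field is constant:
   `u(t₀, ·) ≡ b` (`eq_of_curl_eq_zero_of_isDivFree_of_bounded`).
4. *Forward.* `u(t, ·) ≡ b` for `t₀ < t < 0` (`eq_const_after_of_slice_const`, uniqueness of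
   bounded Oseen-mild solutions against the constant solution).
5. *Backward.* Each analytic time curve `s ↦ u(s, x)` agrees with the constant `b` on `(t₀, 0)`,
   hence on the connected `(−∞, 0)` (identity theorem).
6. *Gauge.* Every slice is the constant `b`, and the KNSS gauge kills slice-constant elements
   (`IsTypeIAncientMild.eq_zero_of_slice_const`, KNSS 2009 Remark 6.1).

The companions `openSetVelocityLiouville` (the velocity of ONE slice vanishes on a nonempty open
set) and `irrotationalSliceLiouville` (one irrotational slice) are recorded on the way.

## References

* G. Koch, N. Nadirashvili, G. Seregin, V. Šverák, *Liouville theorems for the Navier–Stokes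
  equations and applications*, Acta Math. 203 (2009) 83–105 = arXiv:0709.3599, Lemma 3.1, §4,
  Remark 6.1. [KochNadirashviliSereginSverak2009]
* P. G. Lemarié-Rieusset, *The Navier–Stokes Problem in the 21st Century*, CRC Press 2016,
  Thm. 9.12 (space–time analyticity of bounded mild solutions). [LemarieRieusset2016]
-/

noncomputable section

-- the summit and its single sub-problem share the name (CONVENTIONS §1), as in every Theorems file
set_option linter.dupNamespace false

namespace Summit.NavierStokesRegularity.NavierStokesRegularity.Theorems

open MeasureTheory Set Function Filter Topology
open Literature.Analysis Literature.Analysis.FluidPDE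

section OpenSetVorticityLiouville

variable {C : ℝ} {u : ℝ → EuclideanSpace ℝ (Fin 3) → EuclideanSpace ℝ (Fin 3)}

/-- **Joint real-analyticity of class elements**: for `u` in the Type-I ancient mild class,
`uncurry u` is real-analytic on the open slab `(−∞, 0) × ℝ³` (`analyticOnNhd_uncurry_of_oseenMild`
fed with the class API: joint smoothness, the Oseen integral equation with the caloric extension,
the Type-I bound). [cite: LemarieRieusset2016, Thm. 9.12 (PDF p. 260)] -/
theorem openSetLiouville_analyticOnNhd_uncurry (h : IsTypeIAncientMild C u) :
    AnalyticOnNhd ℝ (uncurry u) (Iio 0 ×ˢ (univ : Set (EuclideanSpace ℝ (Fin 3)))) :=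
  analyticOnNhd_uncurry_of_oseenMild h.contDiffOn
    (fun _ _ hst ht x => h.mild_eq_heatExtension hst ht x) h.hasTypeITimeDecay

/-- **A constant slice propagates to ALL times**: if `u(t₀, ·) ≡ b` for one `t₀ < 0` then
`u(t, x) = b` for every `t < 0` — forward (`t₀ < t < 0`) by the uniqueness of bounded Oseen-mild
solutions against the constant solution (`eq_const_after_of_slice_const`), and then on the whole
connected interval `(−∞, 0)` by the identity theorem for the analytic time curve `s ↦ u(s, x)`,
which agrees with the constant `b` on the open subinterval `(t₀, 0) ∋ t₀/2`.
[cite: KochNadirashviliSereginSverak2009, §4 p. 8 (arXiv:0709.3599)] -/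
theorem openSetLiouville_eq_const_of_slice_const (h : IsTypeIAncientMild C u) {t₀ : ℝ}
    (ht₀ : t₀ < 0) {b : EuclideanSpace ℝ (Fin 3)} (hb : ∀ x, u t₀ x = b) {t : ℝ} (ht : t < 0)
    (x : EuclideanSpace ℝ (Fin 3)) : u t x = b := by
  have han := openSetLiouville_analyticOnNhd_uncurry h
  -- the analytic time curve through `x`
  have hG : AnalyticOnNhd ℝ (fun s => u s x) (Iio 0) := fun s hs =>
    (han (s, x) (mk_mem_prod hs (mem_univ _))).curry_left
  -- it is the constant `b` near `t₀ / 2`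
  have heq : (fun s => u s x) =ᶠ[𝓝 (t₀ / 2)] fun _ => b := by
    have hmem : Ioo t₀ 0 ∈ 𝓝 (t₀ / 2) := Ioo_mem_nhds (by linarith) (by linarith)
    filter_upwards [hmem] with s hs using eq_const_after_of_slice_const h hb hs.1 hs.2 x
  have hz₀ : t₀ / 2 ∈ Iio (0 : ℝ) := by
    show t₀ / 2 < 0
    linarith
  exact hG.eqOn_of_preconnected_of_eventuallyEq analyticOnNhd_const isPreconnected_Iio hz₀ heq ht

/-- **One constant slice kills a class element**: if `u(t₀, ·) ≡ b` for one `t₀ < 0` then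
`u ≡ 0` on `t < 0` — every slice is the constant `b` (`openSetLiouville_eq_const_of_slice_const`)
and the KNSS gauge kills slice-constant elements (`IsTypeIAncientMild.eq_zero_of_slice_const`).
[cite: KochNadirashviliSereginSverak2009, Remark 6.1 (arXiv:0709.3599 p. 11)] -/
theorem sliceConstLiouville (h : IsTypeIAncientMild C u) {t₀ : ℝ} (ht₀ : t₀ < 0)
    {b : EuclideanSpace ℝ (Fin 3)} (hb : ∀ x, u t₀ x = b) : ∀ t < 0, ∀ x, u t x = 0 :=
  fun _ ht x => h.eq_zero_of_slice_const (b := fun _ => b)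
    (fun _ hs y => openSetLiouville_eq_const_of_slice_const h ht₀ hb hs y) ht x

/-- **One irrotational slice kills a class element**: if `curl u(t₀, ·) ≡ 0` for one `t₀ < 0`
then `u ≡ 0` on `t < 0` — the bounded curl-free divergence-free slice is constant (KNSS 2009
Lemma 3.1, `eq_of_curl_eq_zero_of_isDivFree_of_bounded`) and `sliceConstLiouville` concludes.
[cite: KochNadirashviliSereginSverak2009, Lemma 3.1 (arXiv:0709.3599)] -/
theorem irrotationalSliceLiouville (h : IsTypeIAncientMild C u) {t₀ : ℝ} (ht₀ : t₀ < 0)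
    (hcurl : ∀ x, curl (u t₀) x = 0) : ∀ t < 0, ∀ x, u t x = 0 :=
  sliceConstLiouville h ht₀ (b := u t₀ 0) fun x =>
    eq_of_curl_eq_zero_of_isDivFree_of_bounded ((h.contDiff_slice ht₀).of_le (by norm_cast)) hcurl
      (h.isDivFree ht₀) (fun z => h.norm_le ht₀ z) x 0

/-- **The vorticity of a nonzero class element has no open zero set on any slice**: if
`curl u(t₀, ·)` vanishes on a nonempty open `U ⊆ ℝ³` for one `t₀ < 0` then `u ≡ 0` on `t < 0` —
the slice is real-analytic (`analyticOnNhd_slice` of the joint analyticity), so its curl vanishes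
identically by the identity theorem (`curl_eq_zero_of_eqOn_open`), and
`irrotationalSliceLiouville` concludes. [cite: KochNadirashviliSereginSverak2009, Lemma 3.1 and Remark 6.1 (arXiv:0709.3599)] -/
theorem openSetVorticityLiouville (h : IsTypeIAncientMild C u) {t₀ : ℝ} (ht₀ : t₀ < 0)
    {U : Set (EuclideanSpace ℝ (Fin 3))} (hU : IsOpen U) (hne : U.Nonempty)
    (hcurl : ∀ x ∈ U, curl (u t₀) x = 0) : ∀ t < 0, ∀ x, u t x = 0 :=
  irrotationalSliceLiouville h ht₀
    (curl_eq_zero_of_eqOn_open (analyticOnNhd_slice (openSetLiouville_analyticOnNhd_uncurry h) ht₀)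
      hU hne hcurl)

/-- **The velocity of a nonzero class element has no open zero set on any slice**: if `u(t₀, ·)`
vanishes on a nonempty open `U ⊆ ℝ³` for one `t₀ < 0` then `u ≡ 0` on `t < 0` — the real-analytic
slice vanishes identically on the connected `ℝ³` (identity theorem), and `sliceConstLiouville`
with `b = 0` concludes. [cite: KochNadirashviliSereginSverak2009, Remark 6.1 (arXiv:0709.3599 p. 11)] -/
theorem openSetVelocityLiouville (h : IsTypeIAncientMild C u) {t₀ : ℝ} (ht₀ : t₀ < 0)
    {U : Set (EuclideanSpace ℝ (Fin 3))} (hU : IsOpen U) (hne : U.Nonempty)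
    (h0 : ∀ x ∈ U, u t₀ x = 0) : ∀ t < 0, ∀ x, u t x = 0 := by
  obtain ⟨x₀, hx₀⟩ := hne
  have hslice : AnalyticOnNhd ℝ (u t₀) univ :=
    analyticOnNhd_slice (openSetLiouville_analyticOnNhd_uncurry h) ht₀
  have hev : u t₀ =ᶠ[𝓝 x₀] 0 := Filter.eventually_of_mem (hU.mem_nhds hx₀) h0
  have hzero := hslice.eqOn_zero_of_preconnected_of_eventuallyEq_zero isPreconnected_univ
    (mem_univ x₀) hev
  exact sliceConstLiouville h ht₀ (b := 0) fun x => hzero (mem_univ x)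

end OpenSetVorticityLiouville

/-- **Stub `stub_openSetVorticityLiouville` (crux stmt-NavierStokesRegularity-10570, line
`registered`, portrait clause S)**: the vorticity of a nonzero Type-I ancient mild field has NO
open zero set on any time slice — if `curl u(t₀, ·)` vanishes on a nonempty open `U` for one
`t₀ < 0` then `u ≡ 0` on `t < 0` (joint real-analyticity + identity theorem + KNSS 2009 Lemma 3.1
+ forward uniqueness + time analyticity + the KNSS gauge; `openSetVorticityLiouville`).
[cite: KochNadirashviliSereginSverak2009, Lemma 3.1 and Remark 6.1 (arXiv:0709.3599)] -/
theorem stub_openSetVorticityLiouville : ∀ (C : ℝ) (u : ℝ → EuclideanSpace ℝ (Fin 3) → EuclideanSpace ℝ (Fin 3)), Literature.Analysis.FluidPDE.IsTypeIAncientMild C u → ∀ (t₀ : ℝ) (U : Set (EuclideanSpace ℝ (Fin 3))), t₀ < 0 → IsOpen U → U.Nonempty → (∀ x ∈ U, Literature.Analysis.FluidPDE.curl (u t₀) x = 0) → ∀ t < 0, ∀ x, u t x = 0 :=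
  fun _ _ h _ _ ht₀ hU hne hcurl => openSetVorticityLiouville h ht₀ hU hne hcurl

end Summit.NavierStokesRegularity.NavierStokesRegularity.Theorems

end
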